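import Summits.MatrixMultiplication.OmegaCensus.BoxBadClass3A
import Summits.MatrixMultiplication.OmegaCensus.BoxBadClass3B

/-!
# ω-census, family (b3): conjecture C9 (b) — extracting the class-`3` configurations from commutator VALUES

HONEST FRAMING (pub-omega census; verbatim): lottery ticket; floor = certified bounds/negative ranges.
Census BOOKKEEPING (conjecture C9 of the cell, STRUCTURE.md §2; pub-omega kernel-l4 gen 15, task K-4; step 4 of the blueprint in the seat
memo K4 §9/§9b).  `BoxBadClass3A/B` need an explicit pair `(h, g)` with `c = [h,g]`, `c g = g c` and `[c, h] = z`.  This file produces it from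
the hypothesis the induction (successor file) will provide: every commutator VALUE of `G` lies in `{1, z, c, cz}` with `z` a central involution,
`c² ∈ {1, z}`, `c` occurs as a commutator and `c` is NOT central.
* `conj_mem_pair`: every conjugate of `c` is `c` or `cz` (conjugates of commutators are commutators; `1` and `z` are excluded);
* `comm_c_of_not_comm`: if `h` does not commute with `c` then `c h c⁻¹ h⁻¹ = z`;
* **`exists_class3_config`**: some `g, h, c'` with `h g h⁻¹ g⁻¹ = c'`, `c' g = g c'`, `c' h c'⁻¹ h⁻¹ = z`, `c' c' = c c` (normalising the given pair:
  both outside the centraliser ⇒ replace `g` by `g h`; both inside ⇒ use a non-commuting `m` and the value of `[m, g]`);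
* **`not_boxUseful_of_class3_values`**: such `G` is NOT box-useful (`c² = z` ⇒ `BoxBadClass3A`, `c² = 1` ⇒ `BoxBadClass3B`).
Nothing here is progress on `ω`.
-/

namespace Summit.MatrixMultiplication.OmegaCensus

open Finset ProductBoxBound

namespace CommPairs

variable {G : Type*} [Group G]

section Values

variable {c z : G} (hz : z ∈ Subgroup.center G) (hz1 : z ≠ 1) (hzz : z * z = 1)
  (hvals : ∀ a b : G, a * b * a⁻¹ * b⁻¹ = 1 ∨ a * b * a⁻¹ * b⁻¹ = z ∨ a * b * a⁻¹ * b⁻¹ = c ∨ a * b * a⁻¹ * b⁻¹ = c * z)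
  {h₀ g₀ : G} (h0 : h₀ * g₀ * h₀⁻¹ * g₀⁻¹ = c) (hnc : ∃ m : G, m * c ≠ c * m)
include hz hz1 hzz hvals h0 hnc

omit hz1 hzz in
/-- Every conjugate of `c` is `c` or `c z`. [folklore] -/
theorem conj_mem_pair (g : G) : g * c * g⁻¹ = c ∨ g * c * g⁻¹ = c * z := by
  have zc : ∀ t : G, t * z = z * t := fun t => Subgroup.mem_center_iff.mp hz t
  have key : (g * h₀ * g⁻¹) * (g * g₀ * g⁻¹) * (g * h₀ * g⁻¹)⁻¹ * (g * g₀ * g⁻¹)⁻¹ = g * c * g⁻¹ := by rw [← h0]; group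
  obtain ⟨m, hm⟩ := hnc
  rcases hvals (g * h₀ * g⁻¹) (g * g₀ * g⁻¹) with e | e | e | e <;> rw [key] at e
  · exfalso; apply hm
    have : c = 1 := by
      calc c = g⁻¹ * (g * c * g⁻¹) * g := by group
        _ = 1 := by rw [e]; group
    rw [this, mul_one, one_mul]
  · exfalso; apply hm
    have : c = z := by
      calc c = g⁻¹ * (g * c * g⁻¹) * g := by group
        _ = g⁻¹ * z * g := by rw [e]
        _ = z := by rw [mul_assoc, ← zc g]; group
    rw [this, zc m]
  · exact Or.inl e
  · exact Or.inr e

omit hz1 in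
/-- If `h` does not commute with `c` then `c h c⁻¹ h⁻¹ = z`. [folklore] -/
theorem comm_c_of_not_comm {h : G} (hh : h * c ≠ c * h) : c * h * c⁻¹ * h⁻¹ = z := by
  have zc : ∀ t : G, t * z = z * t := fun t => Subgroup.mem_center_iff.mp hz t
  have iz : z⁻¹ = z := by rw [inv_eq_iff_mul_eq_one, hzz]
  rcases conj_mem_pair hz hvals h0 hnc h with e | e
  · exact absurd (by calc h * c = h * c * h⁻¹ * h := by group
                          _ = c * h := by rw [e]) hh
  · calc c * h * c⁻¹ * h⁻¹ = c * (h * c * h⁻¹)⁻¹ := by group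
      _ = c * (c * z)⁻¹ := by rw [e]
      _ = c * (z⁻¹ * c⁻¹) := by rw [mul_inv_rev]
      _ = c * (c⁻¹ * z) := by rw [iz, ← zc c⁻¹]
      _ = z := by group

omit hz1 in
/-- **Normalised class-`3` pair**: `g` commuting with the commutator, `h` not. [folklore] -/
theorem exists_class3_config (hc2 : c * c = 1 ∨ c * c = z) :
    ∃ g h c' : G, h * g * h⁻¹ * g⁻¹ = c' ∧ c' * g = g * c' ∧ c' * h * c'⁻¹ * h⁻¹ = z ∧ c' * c' = c * c := by
  have zc : ∀ t : G, t * z = z * t := fun t => Subgroup.mem_center_iff.mp hz t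
  have iz : z⁻¹ = z := by rw [inv_eq_iff_mul_eq_one, hzz]
  have hcz2 : (c * z) * (c * z) = c * c := by
    calc (c * z) * (c * z) = c * (z * c) * z := by group
      _ = c * (c * z) * z := by rw [← zc c]
      _ = c * c := by rw [mul_assoc, mul_assoc, hzz, mul_one]
  -- commuting with `c` and with `c z` is the same thing
  have Ccz : ∀ {g : G}, c * g = g * c → (c * z) * g = g * (c * z) := fun {g} hg => by
    calc c * z * g = c * (z * g) := by group
      _ = c * (g * z) := by rw [zc g]
      _ = (c * g) * z := by group
      _ = (g * c) * z := by rw [hg]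
      _ = g * (c * z) := by group
  have notC : ∀ {h : G}, h * c ≠ c * h → ∀ c' : G, (c' = c ∨ c' = c * z) → c' * h * c'⁻¹ * h⁻¹ = z := by
    intro h hh c' hc'
    rcases hc' with rfl | rfl
    · exact comm_c_of_not_comm hz hzz hvals h0 hnc hh
    · have e := comm_c_of_not_comm hz hzz hvals h0 hnc hh
      calc c * z * h * (c * z)⁻¹ * h⁻¹ = c * (z * h) * z⁻¹ * c⁻¹ * h⁻¹ := by group
        _ = c * (h * z) * z⁻¹ * c⁻¹ * h⁻¹ := by rw [zc h]
        _ = c * h * c⁻¹ * h⁻¹ := by group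
        _ = z := e
  obtain ⟨m, hm⟩ := hnc
  by_cases hg0 : c * g₀ = g₀ * c
  · by_cases hh0 : h₀ * c = c * h₀
    · -- both commute with `c`: use `m`
      have hmh : (h₀ * m) * c ≠ c * (h₀ * m) := by
        intro e; apply hm
        calc m * c = h₀⁻¹ * ((h₀ * m) * c) := by group
          _ = h₀⁻¹ * (c * (h₀ * m)) := by rw [e]
          _ = h₀⁻¹ * (c * h₀) * m := by group
          _ = h₀⁻¹ * (h₀ * c) * m := by rw [hh0]
          _ = c * m := by group
      have prodrule : ∀ x : G, (h₀ * m) * g₀ * (h₀ * m)⁻¹ * g₀⁻¹ = h₀ * (m * g₀ * m⁻¹ * g₀⁻¹) * h₀⁻¹ * (h₀ * g₀ * h₀⁻¹ * g₀⁻¹) :=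
        fun _ => by group
      rcases hvals m g₀ with e | e | e | e
      · refine ⟨g₀, h₀ * m, c, ?_, hg0, notC hmh c (Or.inl rfl), rfl⟩
        rw [prodrule 1, e, h0]; group
      · refine ⟨g₀, h₀ * m, c * z, ?_, Ccz hg0, notC hmh (c * z) (Or.inr rfl), hcz2⟩
        rw [prodrule 1, e, h0, mul_assoc h₀, ← zc h₀⁻¹]
        calc h₀ * (h₀⁻¹ * z) * c = z * c := by group
          _ = c * z := (zc c).symm
      · exact ⟨g₀, m, c, e, hg0, notC hm c (Or.inl rfl), rfl⟩
      · exact ⟨g₀, m, c * z, e, Ccz hg0, notC hm (c * z) (Or.inr rfl), hcz2⟩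
    · exact ⟨g₀, h₀, c, h0, hg0, notC hh0 c (Or.inl rfl), rfl⟩
  · -- `g₀` does not commute with `c`
    have hg0' : g₀ * c ≠ c * g₀ := fun e => hg0 e.symm
    by_cases hh0 : h₀ * c = c * h₀
    · -- swap the pair: `[g₀, h₀] = c⁻¹`
      have hci : c⁻¹ = c ∨ c⁻¹ = c * z := by
        rcases hc2 with e | e
        · left; rw [inv_eq_iff_mul_eq_one, e]
        · right; rw [inv_eq_iff_mul_eq_one]
          calc c * (c * z) = (c * c) * z := by group
            _ = 1 := by rw [e, hzz]
      have hinv : g₀ * h₀ * g₀⁻¹ * h₀⁻¹ = c⁻¹ := by rw [← h0]; group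
      have hsq : c⁻¹ * c⁻¹ = c * c := by
        rcases hci with e | e
        · rw [e]
        · rw [e, hcz2]
      refine ⟨h₀, g₀, c⁻¹, hinv, ?_, notC hg0' c⁻¹ hci, hsq⟩
      calc c⁻¹ * h₀ = c⁻¹ * (h₀ * c) * c⁻¹ := by group
        _ = c⁻¹ * (c * h₀) * c⁻¹ := by rw [hh0]
        _ = h₀ * c⁻¹ := by group
    · -- neither commutes: `g₀ h₀` commutes with `c`, and `[h₀, g₀ h₀] = c`
      have e1 : g₀ * c * g₀⁻¹ = c * z := (conj_mem_pair hz hvals h0 ⟨m, hm⟩ g₀).resolve_left fun e => hg0' (by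
        calc g₀ * c = g₀ * c * g₀⁻¹ * g₀ := by group
          _ = c * g₀ := by rw [e])
      have e2 : h₀ * c * h₀⁻¹ = c * z := (conj_mem_pair hz hvals h0 ⟨m, hm⟩ h₀).resolve_left fun e => hh0 (by
        calc h₀ * c = h₀ * c * h₀⁻¹ * h₀ := by group
          _ = c * h₀ := by rw [e])
      refine ⟨g₀ * h₀, h₀, c, ?_, ?_, notC hh0 c (Or.inl rfl), rfl⟩
      · rw [← h0]; group
      · calc c * (g₀ * h₀) = (g₀ * h₀) * ((g₀ * h₀)⁻¹ * c * (g₀ * h₀)) := by group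
          _ = (g₀ * h₀) * c := by
              congr 1
              -- `(g₀ h₀)⁻¹ c (g₀ h₀) = c`: conjugating twice by elements that flip `c ↦ c z`
              have f1 : h₀⁻¹ * c * h₀ = c * z := by
                calc h₀⁻¹ * c * h₀ = h₀⁻¹ * (z * (z * c)) * h₀ := by rw [← mul_assoc z, hzz, one_mul]
                  _ = h₀⁻¹ * (z * (c * z)) * h₀ := by rw [zc c]
                  _ = h₀⁻¹ * (z * (h₀ * c * h₀⁻¹)) * h₀ := by rw [← e2]
                  _ = z * c := by rw [← mul_assoc h₀⁻¹ z, zc h₀⁻¹]; group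
                  _ = c * z := (zc c).symm
              have f2 : g₀⁻¹ * c * g₀ = c * z := by
                calc g₀⁻¹ * c * g₀ = g₀⁻¹ * (c * z) * g₀ * (g₀⁻¹ * z⁻¹ * g₀) := by group
                  _ = g₀⁻¹ * (g₀ * c * g₀⁻¹) * g₀ * (g₀⁻¹ * z⁻¹ * g₀) := by rw [e1]
                  _ = c * (g₀⁻¹ * z⁻¹ * g₀) := by group
                  _ = c * z := by rw [iz, zc g₀⁻¹]; group
              calc (g₀ * h₀)⁻¹ * c * (g₀ * h₀) = h₀⁻¹ * (g₀⁻¹ * c * g₀) * h₀ := by group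
                _ = h₀⁻¹ * (c * z) * h₀ := by rw [f2]
                _ = (h₀⁻¹ * c * h₀) * (h₀⁻¹ * z * h₀) := by group
                _ = (c * z) * (z * h₀⁻¹ * h₀) := by rw [f1, zc h₀⁻¹]
                _ = c * (z * z) := by group
                _ = c := by rw [hzz, mul_one]

/-- **A finite group whose commutator values lie in `{1, z, c, cz}` (`z` a central involution, `c² ∈ {1, z}`, `c` a non-central
commutator) is NOT box-useful.** [folklore] -/
theorem not_boxUseful_of_class3_values [Fintype G] [DecidableEq G] (hc2 : c * c = 1 ∨ c * c = z) : ¬ BoxUseful G := by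
  obtain ⟨g, h, c', h1, h2, h3, h4⟩ := exists_class3_config hz hzz hvals h0 hnc hc2
  rcases hc2 with e | e
  · exact not_boxUseful_of_class3B h1 h2 h3 hz (h4.trans e) hz1 hzz
  · exact not_boxUseful_of_class3A h1 h2 h3 hz (h4.trans e) hz1 hzz

end Values

end CommPairs

end Summit.MatrixMultiplication.OmegaCensus
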